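import Summits.ABC.ABC.Theses.IsogenyGlueCongruence
import Summits.ABC.ABC.Theorems.IsogenyGlueCongruencePolyDegreeOfBoundedPrimesHeightCalibrationExact
import Summits.ABC.ABC.Theorems.IsogenyGlueCongruencePolyDegreeOfBoundedPrimesOptimalCalibrationItems
import Summits.ABC.ABC.Theorems.IsogenyGlueCongruenceSemistableManinBound2
import Summits.ABC.ABC.Theorems.IsogenyGlueCongruenceMazurKenkuBoundEdixhoven
import Literature.NumberTheory.Automorphic.ShimuraCurveRibetTakahashiSemistableManinProofs
import HarnessLib

/-!
# Crux B (`PolyDegreeOfBoundedPrimes`, stmt-ABC-2046), line `Sketch` v7: crux B in ITEM vocabulary —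
# `B ↔ (B' ∧ (A → SemistableManinBound2))`, hypothesis-free

Lead c5 (cycle 6, 2026-08-17). Write `A = DegreePrimesPolyBounded` (crux, stmt-ABC-2045),
`B = PolyDegreeOfBoundedPrimes = (A → P)` (this crux), `B' = PolyHeightOfBoundedPrimes = (A → H)` (crux,
stmt-ABC-16006), `SMB2 = SemistableManinBound2` (support, rank 9, known in print, stmt-ABC-16014), where

* `P` = the polynomial modular-degree statement for semistable curves (`∃ κ C, ∀ W semistable globally
  minimal, ∃ D, deg D ≤ C · N_W^κ`, the consequent of B);
* `H` = the polynomial height conjecture for semistable curves (`∃ σ C, … max(|Δ_W|, |c₄(W)|³) ≤ C · N_W^σ`,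
  the consequent of B'; Frey 1989 = Pasten–Shimura 2024 Conj. 3.1 restricted to semistable curves);
* `M` = polynomially bounded Manin data (`∃ a M₀, ∀ W semistable globally minimal, ∃ D, |c_D| ≤ M₀ · N_W^a`).

The cycle-3 calibration of this line is the unconditional `B ↔ (A → H ∧ M)`
(`polyDegreeOfBoundedPrimes_iff_height_and_manin`, p111354). Since then the planner ITEMISED both halves of
the right-hand side: `A → H` is the crux B' (stmt-ABC-16006) and the Manin package is the support item SMB2
(stmt-ABC-16014: every globally minimal elliptic `W/ℚ` with a datum at a square-free level `N` has a datum at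
level `N` with `|c| ≤ M₀ · N^a`; in print `a = 0`, `M₀ = 163`, even `M₀ = 1` by Česnavičius 2018). This file
records crux B EXACTLY in that vocabulary, with no hypothesis left over:

* `semistableManinBound2_iff_maninData_of_degreePrimes` — granted A (which supplies a datum of every
  semistable globally minimal curve), `SMB2 ↔ M`: `→` feeds the datum of A into the item; `←` is Carayol's
  theorem at square-free level (`N = N_W`, `W` semistable — theorems of the tree,
  `IsNewformOf.level_eq_conductorNorm_of_squarefree_level`, `IsNewformOf.isSemistable_of_squarefree_level`);
* `polyDegreeOfBoundedPrimes_of_semistableManinBound2_of_polyHeightOfBoundedPrimes` — **the glue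
  `SMB2 → B' → B`** (the line v7: its composition with the single registered stub `B'`);
* `polyDegreeOfBoundedPrimes_iff_polyHeightOfBoundedPrimes_of_semistableManinBound2` — `SMB2 → (B ↔ B')`;
* `polyDegreeOfBoundedPrimes_iff_polyHeightOfBoundedPrimes_and_semistableManinBound2` —
  **`B ↔ (B' ∧ (A → SMB2))`, hypothesis-free**: crux B is the conjunction of crux B' and of the implication
  from crux A to the known-in-print support item SMB2 — nothing more, nothing less;
* the same over the twin item `SemistableManinBound` (stmt-ABC-16013, `|c| ≤ M₀`), and `P ↔ H` given SMB2 and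
  `ModularDatumExists` (stmt-ABC-15126);
* `stub_edixhovenFact` — the registered stub ED of skeleton v6, CLOSED by that tree theorem (verbatim signature);
* the cycle-5 bridges with their Edixhoven hypothesis DISCHARGED — Edixhoven 1991 Prop. 2 in lattice form is
  now a theorem of the tree (`edixhoven_int_of_neronLattice_eq_smul_periodLattice_of_flexLine`, item
  stmt-ABC-15990 closed): `Česnavičius → MazurKenkuBound → (B ↔ B')` and
  `Česnavičius → MazurKenkuBound → NéronScaling → SMB2`.

No definition, no new named fact, no `sorry`; supports stmt-ABC-2046.

## References

* G. Frey, *Links between solutions of A − B = C and elliptic curves* (1989), height conjecture. [Frey1989]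
* M. R. Murty, *Bounds for congruence primes* (1999), Thm. 1 (ii), §2. [MurtyCongruencePrimes1999]
* H. Pasten, *Shimura curves and the abc conjecture*, J. Number Theory 254 (2024), §3 p. 13, Conj. 3.1–3.2.
  [PastenShimura2024]
* B. Edixhoven, *On the Manin constants of modular elliptic curves* (1991), Prop. 2. [EdixhovenManin1991]
* K. Česnavičius, *The Manin constant in the semistable case*, Compositio Math. 154 (2018), Thm. 1.2.
  [Cesnavicius2018]
* F. Diamond, J. Shurman, *A first course in modular forms* (2005), Thm. 8.8.1 (Carayol). [DiamondShurman2005]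
-/

noncomputable section

-- single-conjunct summit ABC: the duplicate ABC.ABC is mandated (CONVENTIONS §2)
set_option linter.dupNamespace false

namespace Summit.ABC.ABC.Theorems

open Literature.NumberTheory.EllipticCurves Literature.NumberTheory.EllipticCurves.ModularForms
open CongruenceSubgroup
open Summit.ABC.ABC.Theses.IsogenyGlueCongruence

/-! ## The Manin input `M` is the item `SemistableManinBound2` (granted a datum) -/

/-- **`SMB2 →` Manin data for every semistable globally minimal curve that has a datum.** A semistable `W`
has square-free conductor (`WeierstrassCurve.isSemistable_iff_squarefree_conductorNorm`), so the item applies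
at the level `N_W` to any datum of `W`. [folklore] -/
theorem maninDataGivenData_of_semistableManinBound2 (hMan : SemistableManinBound2) :
    ∃ a M₀ : ℝ, ∀ (W : WeierstrassCurve ℚ) [W.IsElliptic] [W.IsGloballyMinimal]
      [NeZero (W.conductorNorm ℤ)], W.IsSemistable ℤ →
      Nonempty (ModularParametrizationData W (W.conductorNorm ℤ)) →
      ∃ D : ModularParametrizationData W (W.conductorNorm ℤ),
        |(D.maninConstant : ℝ)| ≤ M₀ * (W.conductorNorm ℤ : ℝ) ^ a := by
  obtain ⟨a, M₀, h⟩ := hMan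
  refine ⟨a, M₀, fun W _ _ _ hss hne ↦ ?_⟩
  obtain ⟨D⟩ := hne
  exact h (W.conductorNorm ℤ) W D ((W.isSemistable_iff_squarefree_conductorNorm).mp hss)

/-- **`SMB2 → A → M`**: crux A supplies a datum of every semistable globally minimal curve (its only use),
and the item bounds the Manin constant of some datum polynomially. [folklore] -/
theorem maninData_of_semistableManinBound2_of_degreePrimes (hMan : SemistableManinBound2)
    (hA : DegreePrimesPolyBounded) :
    ∃ a M₀ : ℝ, ∀ (W : WeierstrassCurve ℚ) [W.IsElliptic] [W.IsGloballyMinimal]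
      [NeZero (W.conductorNorm ℤ)], W.IsSemistable ℤ →
      ∃ D : ModularParametrizationData W (W.conductorNorm ℤ),
        |(D.maninConstant : ℝ)| ≤ M₀ * (W.conductorNorm ℤ : ℝ) ^ a := by
  obtain ⟨a, M₀, h⟩ := maninDataGivenData_of_semistableManinBound2 hMan
  obtain ⟨κ, C, hA⟩ := hA
  refine ⟨a, M₀, fun W _ _ _ hss ↦ ?_⟩
  obtain ⟨D, -⟩ := hA W hss
  exact h W hss ⟨D⟩

/-- **`SMB2 → ModularDatumExists → M`**: the same with the datum supplied by modularity (the route item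
`ModularDatumExists`, stmt-ABC-15126) instead of crux A. [folklore] -/
theorem maninData_of_semistableManinBound2_of_modularDatumExists (hMan : SemistableManinBound2)
    (hMod : ModularDatumExists) :
    ∃ a M₀ : ℝ, ∀ (W : WeierstrassCurve ℚ) [W.IsElliptic] [W.IsGloballyMinimal]
      [NeZero (W.conductorNorm ℤ)], W.IsSemistable ℤ →
      ∃ D : ModularParametrizationData W (W.conductorNorm ℤ),
        |(D.maninConstant : ℝ)| ≤ M₀ * (W.conductorNorm ℤ : ℝ) ^ a := by
  obtain ⟨a, M₀, h⟩ := maninDataGivenData_of_semistableManinBound2 hMan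
  exact ⟨a, M₀, fun W _ _ _ hss ↦ h W hss (hMod W)⟩

/-- **`M → SMB2`** (the converse packaging, Carayol's theorem at square-free level): a globally minimal
elliptic `W` with a datum `D` at a square-free level `N` is semistable with `N = N_W`
(`IsNewformOf.isSemistable_of_squarefree_level`, `IsNewformOf.level_eq_conductorNorm_of_squarefree_level`,
theorems of the tree by `q`-expansion arithmetic), so the Manin data `M` at level `N_W` are data at level `N`.
[cite: DiamondShurman2005, Thm. 8.8.1] -/
theorem semistableManinBound2_of_maninData
    (hM : ∃ a M₀ : ℝ, ∀ (W : WeierstrassCurve ℚ) [W.IsElliptic] [W.IsGloballyMinimal]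
      [NeZero (W.conductorNorm ℤ)], W.IsSemistable ℤ →
      ∃ D : ModularParametrizationData W (W.conductorNorm ℤ),
        |(D.maninConstant : ℝ)| ≤ M₀ * (W.conductorNorm ℤ : ℝ) ^ a) :
    SemistableManinBound2 := by
  obtain ⟨a, M₀, h⟩ := hM
  refine ⟨a, M₀, fun N _ W _ _ D hN ↦ ?_⟩
  have hNW : N = W.conductorNorm ℤ := D.isNewformOf.level_eq_conductorNorm_of_squarefree_level hN
  have hss : W.IsSemistable ℤ := D.isNewformOf.isSemistable_of_squarefree_level hN
  subst hNW
  obtain ⟨D', hD'⟩ := h W hss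
  exact ⟨D', hD'⟩

/-- **Granted crux A, `SMB2 ↔ M`**: the support item `SemistableManinBound2` is EXACTLY the Manin input `M`
of the calibration `B ↔ (A → H ∧ M)` (p111354) once a datum of every semistable globally minimal curve is
available. [folklore] -/
theorem semistableManinBound2_iff_maninData_of_degreePrimes (hA : DegreePrimesPolyBounded) :
    SemistableManinBound2 ↔
    (∃ a M₀ : ℝ, ∀ (W : WeierstrassCurve ℚ) [W.IsElliptic] [W.IsGloballyMinimal]
      [NeZero (W.conductorNorm ℤ)], W.IsSemistable ℤ →
      ∃ D : ModularParametrizationData W (W.conductorNorm ℤ),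
        |(D.maninConstant : ℝ)| ≤ M₀ * (W.conductorNorm ℤ : ℝ) ^ a) :=
  ⟨fun hMan ↦ maninData_of_semistableManinBound2_of_degreePrimes hMan hA, semistableManinBound2_of_maninData⟩

/-! ## The glue of line `Sketch` v7 and its exactness -/

/-- **`SMB2 → B' → B` — the glue of crux B in item vocabulary** (line `Sketch` v7: composition
`PolyDegreeOfBoundedPrimes_of (hMan : SemistableManinBound2)` with the single registered stub
`stub_polyHeightOfBoundedPrimes : PolyHeightOfBoundedPrimes`). Given A, the crux B' yields `H`, the item
yields `M` (`maninData_of_semistableManinBound2_of_degreePrimes`), and `H → M → P` is the landed Murty–Zagier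
calibration `polyDegree_of_polyHeight_of_manin` (p102896: Zagier's identity, the Petersson upper bound at
square-free level, Silverman's covolume inequality — theorems of the tree).
[cite: MurtyCongruencePrimes1999, Thm. 1 (ii) and §2] -/
theorem polyDegreeOfBoundedPrimes_of_semistableManinBound2_of_polyHeightOfBoundedPrimes : Summit.ABC.ABC.Theses.IsogenyGlueCongruence.SemistableManinBound2 → Summit.ABC.ABC.Theses.IsogenyGlueCongruence.PolyHeightOfBoundedPrimes → Summit.ABC.ABC.Theses.IsogenyGlueCongruence.PolyDegreeOfBoundedPrimes :=
  fun hMan hB' hA ↦ polyDegree_of_polyHeight_of_manin (hB' hA)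
    (maninData_of_semistableManinBound2_of_degreePrimes hMan hA)

/-- **`SMB → B' → B`**, over the twin item `SemistableManinBound` (stmt-ABC-16013, `|c| ≤ M₀`), through
`semistableManinBound2_of_semistableManinBound` (p117588). [cite: MurtyCongruencePrimes1999, Thm. 1 (ii) and §2] -/
theorem polyDegreeOfBoundedPrimes_of_semistableManinBound_of_polyHeightOfBoundedPrimes
    (hMan : SemistableManinBound) (hB' : PolyHeightOfBoundedPrimes) : PolyDegreeOfBoundedPrimes :=
  polyDegreeOfBoundedPrimes_of_semistableManinBound2_of_polyHeightOfBoundedPrimes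
    (semistableManinBound2_of_semistableManinBound hMan) hB'

/-- **`SMB2 → (B ↔ B')`**: modulo the known-in-print support item, crux B IS crux B' (`→` is the
unconditional `polyHeight_of_polyDegreeOfBoundedPrimes`, p102896). [cite: PastenShimura2024, §3 p. 13] -/
theorem polyDegreeOfBoundedPrimes_iff_polyHeightOfBoundedPrimes_of_semistableManinBound2
    (hMan : SemistableManinBound2) : PolyDegreeOfBoundedPrimes ↔ PolyHeightOfBoundedPrimes :=
  ⟨fun hB hA ↦ polyHeight_of_polyDegreeOfBoundedPrimes hB hA,
    polyDegreeOfBoundedPrimes_of_semistableManinBound2_of_polyHeightOfBoundedPrimes hMan⟩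

/-- **`SMB → (B ↔ B')`**, twin-item form. [cite: PastenShimura2024, §3 p. 13] -/
theorem polyDegreeOfBoundedPrimes_iff_polyHeightOfBoundedPrimes_of_semistableManinBound
    (hMan : SemistableManinBound) : PolyDegreeOfBoundedPrimes ↔ PolyHeightOfBoundedPrimes :=
  polyDegreeOfBoundedPrimes_iff_polyHeightOfBoundedPrimes_of_semistableManinBound2
    (semistableManinBound2_of_semistableManinBound hMan)

/-- **`SMB2 → ModularDatumExists → (P ↔ H)`**: modulo the two known-in-print items, the consequent of crux B
is the polynomial height conjecture for semistable curves (`→`: `polyHeight_of_polyDegree`; `←`: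
`polyDegree_of_polyHeight_of_manin` with `M` from the items). [cite: PastenShimura2024, Conj. 3.1–3.2] -/
theorem polyDegree_iff_polyHeight_of_semistableManinBound2 (hMan : SemistableManinBound2)
    (hMod : ModularDatumExists) :
    (∃ κ C : ℝ, ∀ (W : WeierstrassCurve ℚ) [W.IsElliptic] [W.IsGloballyMinimal]
      [NeZero (W.conductorNorm ℤ)], W.IsSemistable ℤ →
      ∃ D : ModularParametrizationData W (W.conductorNorm ℤ),
        (D.modularDegree : ℝ) ≤ C * (W.conductorNorm ℤ : ℝ) ^ κ) ↔
    (∃ σ C : ℝ, ∀ (W : WeierstrassCurve ℚ) [W.IsElliptic] [W.IsGloballyMinimal]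
      [NeZero (W.conductorNorm ℤ)], W.IsSemistable ℤ →
      ((max |W.Δ| (|W.c₄| ^ 3) : ℚ) : ℝ) ≤ C * (W.conductorNorm ℤ : ℝ) ^ σ) :=
  ⟨polyHeight_of_polyDegree, fun hH ↦ polyDegree_of_polyHeight_of_manin hH
    (maninData_of_semistableManinBound2_of_modularDatumExists hMan hMod)⟩

/-- **Exact calibration of crux B in item vocabulary, hypothesis-free: `B ↔ (B' ∧ (A → SMB2))`.**
`→`: B gives B' (`polyHeight_of_polyDegreeOfBoundedPrimes`) and, granted A, polynomially bounded Manin data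
(`manin_of_polyDegree`, p104128), which ARE the item by Carayol (`semistableManinBound2_of_maninData`).
`←`: the glue. So crux B is precisely "crux B' and (crux A ⟹ the support item `SemistableManinBound2`)";
since that item is a theorem in print (Edixhoven 1991, Česnavičius 2018 / Mazur 1978 + Abbes–Ullmo 1996,
Kenku 1982), the open content of B is B' alone. [cite: PastenShimura2024, §3 p. 13 and Conj. 3.1–3.2] -/
theorem polyDegreeOfBoundedPrimes_iff_polyHeightOfBoundedPrimes_and_semistableManinBound2 : Summit.ABC.ABC.Theses.IsogenyGlueCongruence.PolyDegreeOfBoundedPrimes ↔ (Summit.ABC.ABC.Theses.IsogenyGlueCongruence.PolyHeightOfBoundedPrimes ∧ (Summit.ABC.ABC.Theses.IsogenyGlueCongruence.DegreePrimesPolyBounded → Summit.ABC.ABC.Theses.IsogenyGlueCongruence.SemistableManinBound2)) :=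
  ⟨fun hB ↦ ⟨fun hA ↦ polyHeight_of_polyDegreeOfBoundedPrimes hB hA,
      fun hA ↦ semistableManinBound2_of_maninData (manin_of_polyDegree (hB hA))⟩,
    fun h hA ↦ polyDegree_of_polyHeight_of_manin (h.1 hA)
      (maninData_of_semistableManinBound2_of_degreePrimes (h.2 hA) hA)⟩

/-! ## The v6 registered stub ED is closed: Edixhoven 1991 Prop. 2 (lattice form) is a tree theorem -/

/-- **Stub ED of skeleton v6 of line `Sketch`, CLOSED** — verbatim the registered signature (the body of the
Literature fact `edixhoven_int_of_neronLattice_eq_smul_periodLattice`: a globally minimal elliptic `W'/ℚ` with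
newform `f` whose Néron-type lattice is exactly `q Λ_f`, `q ∈ ℚ`, has `q ∈ ℤ`), now the tree theorem
`edixhoven_int_of_neronLattice_eq_smul_periodLattice_of_flexLine` (finite-height / Honda / Newton-polygon route,
`IsogenyGlueCongruenceMazurKenkuBoundEdixhoven`, item stmt-ABC-15990 closed). [cite: EdixhovenManin1991, Prop. 2]
[cite: AgasheRibetStein2006, Thm. 2.2] -/
theorem stub_edixhovenFact : ∀ {N : ℕ} [NeZero N] {W' : WeierstrassCurve ℚ} [W'.IsElliptic] [W'.IsGloballyMinimal] {f : CuspForm (CongruenceSubgroup.Gamma0 N) 2} {L' : PeriodPair}, Literature.NumberTheory.EllipticCurves.ModularForms.IsNewformOf W' f → Literature.NumberTheory.EllipticCurves.ModularForms.IsNeronLatticeOf (W'.baseChange ℂ) L' → ∀ q : ℚ, (∀ z ∈ Literature.NumberTheory.EllipticCurves.ModularForms.periodLattice f, (q : ℂ) * z ∈ L'.lattice) → (∀ z ∈ L'.lattice, ∃ w ∈ Literature.NumberTheory.EllipticCurves.ModularForms.periodLattice f, z = q * w) → ∃ k : ℤ, (k : ℚ) = q :=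
  @edixhovenIntegrality_proof

/-! ## The cycle-5 bridges with Edixhoven discharged -/

/-- **`Česnavičius → MazurKenkuBound → B' → B`**: the item-form bridge of cycle 5
(`polyDegreeOfBoundedPrimes_of_polyHeight_of_items`, p116449) with its Edixhoven hypothesis DISCHARGED by the
tree theorem `edixhoven_int_of_neronLattice_eq_smul_periodLattice_of_flexLine` (item stmt-ABC-15990 closed).
Remaining inputs: Česnavičius 2018 Thm. 1.2 (universal closure of `abs_maninConstant_eq_one_of_isSemistable`,
named fact) and the route item `MazurKenkuBound` (stmt-ABC-15125). [cite: Cesnavicius2018, Thm. 1.2]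
[cite: EdixhovenManin1991, Prop. 2] -/
theorem polyDegreeOfBoundedPrimes_of_cesnavicius_of_mazurKenku_of_polyHeightOfBoundedPrimes
    (hCes : ∀ {W' : WeierstrassCurve ℚ} {N' : ℕ} [NeZero N']
      (D' : ModularParametrizationData W' N'), D'.abs_maninConstant_eq_one_of_isSemistable)
    (hMK : MazurKenkuBound) (hB' : PolyHeightOfBoundedPrimes) : PolyDegreeOfBoundedPrimes :=
  fun hA ↦ polyDegreeOfBoundedPrimes_of_polyHeight_of_items
    edixhoven_int_of_neronLattice_eq_smul_periodLattice_of_flexLine hCes hMK (hB' hA) hA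

/-- **`Česnavičius → MazurKenkuBound → (B ↔ B')`**, Edixhoven discharged. [cite: Cesnavicius2018, Thm. 1.2] -/
theorem polyDegreeOfBoundedPrimes_iff_polyHeightOfBoundedPrimes_of_cesnavicius_of_mazurKenku
    (hCes : ∀ {W' : WeierstrassCurve ℚ} {N' : ℕ} [NeZero N']
      (D' : ModularParametrizationData W' N'), D'.abs_maninConstant_eq_one_of_isSemistable)
    (hMK : MazurKenkuBound) : PolyDegreeOfBoundedPrimes ↔ PolyHeightOfBoundedPrimes :=
  ⟨fun hB hA ↦ polyHeight_of_polyDegreeOfBoundedPrimes hB hA,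
    polyDegreeOfBoundedPrimes_of_cesnavicius_of_mazurKenku_of_polyHeightOfBoundedPrimes hCes hMK⟩

/-- **`Česnavičius → MazurKenkuBound → NéronScaling → SMB2`** with `a = 0`, `M₀ = 163`: the four-fact package
`semistableManinBound2_of_facts` (p117588) with its Edixhoven hypothesis discharged (`EdixhovenIntegrality` is
the theorem `edixhovenIntegrality_proof`). [cite: Cesnavicius2018, Thm. 1.2] [cite: EdixhovenManin1991, Prop. 2]
[cite: SilvermanATAEC1994, IV.5.1] -/
theorem semistableManinBound2_of_cesnavicius_of_mazurKenku_of_neronScaling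
    (hCes : ∀ {W' : WeierstrassCurve ℚ} {N' : ℕ} [NeZero N']
      (D' : ModularParametrizationData W' N'), D'.abs_maninConstant_eq_one_of_isSemistable)
    (hMK : MazurKenkuBound) (hNS : integral_neronScaling_of_isGloballyMinimal) : SemistableManinBound2 :=
  semistableManinBound2_of_facts edixhovenIntegrality_proof hCes hMK hNS

/-- **`Česnavičius → MazurKenkuBound → NéronScaling → SMB`** (`M₀ = 163`), Edixhoven discharged.
[cite: Cesnavicius2018, Thm. 1.2] [cite: EdixhovenManin1991, Prop. 2] [cite: SilvermanATAEC1994, IV.5.1] -/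
theorem semistableManinBound_of_cesnavicius_of_mazurKenku_of_neronScaling
    (hCes : ∀ {W' : WeierstrassCurve ℚ} {N' : ℕ} [NeZero N']
      (D' : ModularParametrizationData W' N'), D'.abs_maninConstant_eq_one_of_isSemistable)
    (hMK : MazurKenkuBound) (hNS : integral_neronScaling_of_isGloballyMinimal) : SemistableManinBound :=
  semistableManinBound_of_facts edixhovenIntegrality_proof hCes hMK hNS

end Summit.ABC.ABC.Theorems

end
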